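import Literature.NumberTheory.ModularSymbols.CuspidalHomologyPrymFixedPointSpan
import Literature.NumberTheory.EllipticCurves.ModularSymbolsManinDrinfeldGeneralProofs
import HarnessLib

/-!
# Hecke operators on the symbols of the `t`-fixed CUSPS of `X₀(N)` (`9 ∣ N`):
# `(T_p − 2)·{∞, γ∞} ∈ (t − 1)Λ` for `γ ∈ Γ₀(N)` with `|3(a + d) − c| = 6` and primes `p ≡ 1 (mod N)`

Topic `Literature/NumberTheory/ModularSymbols`, sequel to `CuspidalHomologyShiftNorm` (the shift `t = [1, 1/3; 0, 1]`
on `Λ = H₁(X₀(N), ℤ) = periodHomologyHecke N`, `Λ₁ = shiftSubOneLattice = (t − 1)Λ`, `Λ_P = prymLattice`) and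
`CuspidalHomologyPrymFixedPointSpan` (fixed-point symbols).  Requested by the BSD ideation cell `bsd-idea-3`, route
`TameQuarticManinParity`, item E32b `FixedPointSymbolHeckeShift` (stmt-BirchSwinnertonDyer-23757): for `9 ∣ N`, a prime
`p ≡ 1 (mod N)`, `p ≠ 3`, and `γ = (a b; c d) ∈ Γ₀(N)` with `|3(a + d) − c| ≤ 6`, `(T_p − 2)·{∞, γ∞} ∈ (t − 1)Λ`.  Here
`|3(a + d) − c| ∈ {3, 6}` (it is divisible by `3`, and `≠ 0`), and this file PROVES THE CASE `|3(a + d) − c| = 6`, i.e.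
`e := t⁻¹γ ∈ Γ̃ = ⟨Γ₀(N), t⟩` PARABOLIC — the fixed-point symbols of the `t`-fixed CUSPS of `X₀(N)`
(`heckeT_sub_two_smul_symbolInt_mem_shiftSubOneLattice_of_parabolic`).  The case `|3(a + d) − c| = 3` (`e` elliptic of
order `3`: the CM points by `ℤ[ζ₃]`) is the sibling file's business.  Everything here is a THEOREM over decls already in the
tree (`modularSymbol`, `periodFunctional`, `symbolInt`, `shiftDual`, `shiftSubOneLattice`); no named fact, no instance, no
notation, no `sorry`; nothing about any elliptic curve is asserted.

## Proof (functionals on `S₂(Γ₀(N))`; no Jacobian, no uniformisation, no Eichler–Shimura)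

Write `Φ(r) = (h ↦ {∞, r}_h)` for the ray functional of a rational cusp `r` (the tree's `inftyFunctional (cuspMatrix r)`), `t_*` for `shiftDual`
(`(t_*φ)(h) = φ(h ∣ t)`, so `t_*Φ(r) = Φ(r + 1/3)`), and `[γ]` for the period functional `{∞, γ∞}`.
* FIXED CUSP (`inftyFunctional_cuspMatrix_moebius_fixedCusp`): for `|3(a + d) − c| = 6` and `c ≠ 0` the parabolic `e = t⁻¹γ` fixes the cusp
  `x = (3a − c − 3d)/(6c)`, and `γx = x + 1/3` with `cx + d = ±1`; by Manin's relation
  `{∞, γr} = {∞, γ∞} + {∞, r}` (`modularSymbol_gamma0_smul_holds`), `[γ] = Φ(x + 1/3) − Φ(x) = (t_* − 1)Φ(x)`.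
* HECKE ON A SHIFT DIFFERENCE (`dualMap_heckeT_shiftDual_sub_inftyFunctional`): from `{∞, r}_{T_p h} = Σⱼ {∞, (r+j)/p}_h + {∞, pr}_h`
  (`modularSymbol_heckeT_eq_sum`) at `r = x + 1/3` and `r = x`, re-indexing `j ↦ j − (p−1)/3 (mod p)` (which moves
  `(x + 1/3 + j)/p` to `(x + j')/p + 1/3` up to an INTEGER, invisible to `{∞, ·}`) and telescoping
  `Φ(px + p/3) − Φ(px) = Σ_{k<p} (t_* − 1)t_*ᵏΦ(px)`:  `T_p^∨(t_* − 1)Φ(x) = (t_* − 1)[Σⱼ Φ((x+j)/p) + Σ_{k<p} t_*ᵏ Φ(px)]`.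
* CUSP TRANSPORT (`exists_gamma0_mulVec_eq`): if `x/y`, `x'/y'` are cusps in lowest terms with `y' ≡ y (mod N)` and
  `x' ≡ x (mod gcd(y, N))`, some `β ∈ Γ₀(N)` maps `(x, y)` to `(x', y')` (Cremona Prop. 2.2.3 with `u = 1`: `β = g'Tⁿg⁻¹`
  for bases `g, g'` extending the two columns, `n` solving a linear congruence).  For `p ≡ 1 (mod N)` every Hecke
  neighbour `(x + j)/p`, `px` of ANY cusp `x` is therefore a `Γ₀(N)`-translate `βx` of it
  (`exists_gamma0_moebius_eq_add_div`, `exists_gamma0_moebius_eq_mul`), whence `Φ((x+j)/p), Φ(px) ∈ [Γ₀(N)] + Φ(x)`.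
* ASSEMBLY: `T_p^∨[γ] = (t_* − 1)(Z + pΦ(x) + Σ_{k<p}t_*ᵏΦ(x))` with `Z ∈ Λ`; `(t_* − 1)Σ_{k<p}t_*ᵏΦ(x) = (t_*ᵖ − 1)Φ(x) =
  (t_* − 1)Φ(x)` (`t_*³Φ(x) = Φ(x + 1) = Φ(x)`, `p ≡ 1 (mod 3)`); so `T_p^∨[γ] − 2[γ] = (t_* − 1)Z + (p − 1)[γ]`, and
  `3[γ] ∈ (t − 1)Λ` because `[γ] ∈ Λ_P` (`Nm·(t_* − 1)Φ(x) = (t_*³ − 1)Φ(x) = 0`; `three_smul_mem_shiftSubOneLattice`).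
This is the «all `p + 1` neighbours of a ramified cusp are the cusp itself when `p ≡ 1 (mod N)`» mechanism of the cell's
LINE 32 memo, with the winding numbers absorbed into `(t_* − 1)Λ`.

## References

* J. E. Cremona, *Algorithms for modular elliptic curves*, 2nd ed. (1997), §2.1 (2.1.1), Prop. 2.2.3 (equivalence of
  cusps of `Γ₀(N)`), §2.4 (2.4.1)–(2.4.2) (Hecke action on modular symbols). [CremonaAlgorithms1997]
* Ju. I. Manin, *Parabolic points and zeta functions of modular curves*, Izv. 36 (1972), §1.5, Prop. 1.4, §1.6–1.7.
  [Manin1972]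
* G. Shimura, *Introduction to the arithmetic theory of automorphic functions* (1971), §1.3 (parabolic elements and
  their fixed cusps), Prop. 3.36, Prop. 3.64. [Shimura1971]
* M. Harrison, *A new automorphism of `X₀(108)`* (2011), §2 (`t = S₃ : τ ↦ τ + 1/3` on `X₀(N)`, `9 ∣ N`). [Harrison2011X0108]
-/

noncomputable section

open scoped MatrixGroups ModularForm

open CongruenceSubgroup
open Literature.NumberTheory.EllipticCurves.ModularForms

namespace Literature.NumberTheory.ModularSymbols

/-! ### The ray functional `h ↦ {∞, r}_h` of a rational cusp -/

section RayDual

variable (N : ℕ) [NeZero N]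

-- The ray functional `Φ(r) : h ↦ {∞, r}_h` of a rational cusp `r` is the tree's `inftyFunctional (cuspMatrix r)`
-- (`ModularSymbolsManin`, `δ_r ∞ = r`; `inftyFunctional_cuspMatrix_apply` of `ModularSymbolsManinDrinfeldGeneralProofs`).
-- For `r = γ∞` it is the period functional `{∞, γ∞}`; in general it is NOT in the period homology (Manin–Drinfeld).

/-- **`Φ(r + n) = Φ(r)` for `n ∈ ℤ`** (`h ∣ T = h`; the tree's `modularSymbol_add_intCast_holds`). [cite: Manin1972, §1.5 and Prop. 1.4] -/
theorem inftyFunctional_cuspMatrix_add_intCast (r : ℚ) (n : ℤ) : (inftyFunctional (cuspMatrix (r + n)) : Module.Dual ℂ (CuspForm (Gamma0 N) 2)) = (inftyFunctional (cuspMatrix r) : Module.Dual ℂ (CuspForm (Gamma0 N) 2)) := by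
  ext h
  rw [inftyFunctional_cuspMatrix_apply N, inftyFunctional_cuspMatrix_apply N, modularSymbol_add_intCast_holds h r n]

/-- **`t_*Φ(r) = Φ(r + 1/3)`** (`{∞, r}_{h∣t} = {∞, r + 1/3}_h`, `modularSymbol_shiftCuspForm`). [cite: Harrison2011X0108, §2] -/
theorem shiftDual_inftyFunctional_cuspMatrix (h9 : 3 ^ 2 ∣ N) (r : ℚ) : shiftDual N h9 ((inftyFunctional (cuspMatrix r) : Module.Dual ℂ (CuspForm (Gamma0 N) 2))) = (inftyFunctional (cuspMatrix (r + 1 / 3)) : Module.Dual ℂ (CuspForm (Gamma0 N) 2)) := by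
  ext h
  rw [shiftDual_apply, inftyFunctional_cuspMatrix_apply N, inftyFunctional_cuspMatrix_apply N, modularSymbol_shiftCuspForm]

/-- `t_*ᵏ Φ(r) = Φ(r + k/3)`. [cite: Harrison2011X0108, §2] -/
theorem shiftDual_pow_inftyFunctional_cuspMatrix (h9 : 3 ^ 2 ∣ N) (r : ℚ) (k : ℕ) :
    (shiftDual N h9 ^ k) ((inftyFunctional (cuspMatrix r) : Module.Dual ℂ (CuspForm (Gamma0 N) 2))) = (inftyFunctional (cuspMatrix (r + k / 3)) : Module.Dual ℂ (CuspForm (Gamma0 N) 2)) := by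
  induction k with
  | zero => simp
  | succ k ih =>
    rw [pow_succ', Module.End.mul_apply, ih, shiftDual_inftyFunctional_cuspMatrix]
    congr 1
    push_cast
    ring

/-- `t_*³ Φ(r) = Φ(r)` (`Φ(r + 1) = Φ(r)`). [cite: Harrison2011X0108, §2] -/
theorem shiftDual_pow_three_inftyFunctional_cuspMatrix (h9 : 3 ^ 2 ∣ N) (r : ℚ) : (shiftDual N h9 ^ 3) ((inftyFunctional (cuspMatrix r) : Module.Dual ℂ (CuspForm (Gamma0 N) 2))) = (inftyFunctional (cuspMatrix r) : Module.Dual ℂ (CuspForm (Gamma0 N) 2)) := by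
  rw [shiftDual_pow_inftyFunctional_cuspMatrix]
  have e : r + (3 : ℕ) / 3 = r + (1 : ℤ) := by push_cast; ring
  rw [e, inftyFunctional_cuspMatrix_add_intCast]

/-- **Manin's relation for the ray functionals**: `Φ(γr) = {∞, γ∞} + Φ(r)` for `γ = (a b; c d) ∈ Γ₀(N)` and a cusp `r`
with `cr + d ≠ 0` (`{∞, γr} = {∞, γ∞} + {γ∞, γr}` and `{γ∞, γr}_h = {∞, r}_{h∣γ} = {∞, r}_h`; the tree's
`modularSymbol_gamma0_smul_holds`). [cite: Manin1972, §1.5 and Prop. 1.4] -/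
theorem inftyFunctional_cuspMatrix_moebius (γ : Gamma0 N) (r : ℚ)
    (hr : ((γ : SL(2, ℤ)) 1 0 : ℚ) * r + ((γ : SL(2, ℤ)) 1 1 : ℚ) ≠ 0) :
    (inftyFunctional (cuspMatrix ((((γ : SL(2, ℤ)) 0 0 : ℚ) * r + ((γ : SL(2, ℤ)) 0 1 : ℚ)) /
        (((γ : SL(2, ℤ)) 1 0 : ℚ) * r + ((γ : SL(2, ℤ)) 1 1 : ℚ)))) : Module.Dual ℂ (CuspForm (Gamma0 N) 2)) =
      periodFunctional N γ + (inftyFunctional (cuspMatrix r) : Module.Dual ℂ (CuspForm (Gamma0 N) 2)) := by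
  ext h
  rw [inftyFunctional_cuspMatrix_apply N, LinearMap.add_apply, periodFunctional_apply, inftyFunctional_cuspMatrix_apply N,
    modularSymbol_gamma0_smul_holds h γ r hr]

variable {p : ℕ} [NeZero p] (hp : p.Prime)
include hp

/-- **Hecke operators on ray functionals** (`p ∤ N` prime): `T_p^∨ Φ(r) = Σ_{j<p} Φ((r + j)/p) + Φ(pr)` — the transpose of
`{∞, r}_{T_p h} = Σⱼ {∞, (r+j)/p}_h + {∞, pr}_h` (`modularSymbol_heckeT_eq_sum`).
[cite: CremonaAlgorithms1997, §2.4 (2.4.1)–(2.4.2)] -/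
theorem dualMap_heckeT_inftyFunctional_cuspMatrix (hpN : ¬ p ∣ N) (r : ℚ) :
    (heckeT (Gamma0 N) 2 p).dualMap ((inftyFunctional (cuspMatrix r) : Module.Dual ℂ (CuspForm (Gamma0 N) 2))) =
      ∑ j : Fin p, (inftyFunctional (cuspMatrix ((r + ((j : ℕ) : ℤ)) / p)) : Module.Dual ℂ (CuspForm (Gamma0 N) 2)) + (inftyFunctional (cuspMatrix (p * r)) : Module.Dual ℂ (CuspForm (Gamma0 N) 2)) := by
  ext h
  rw [LinearMap.dualMap_apply, inftyFunctional_cuspMatrix_apply N, modularSymbol_heckeT_eq_sum p h hp r, if_neg hpN]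
  simp only [LinearMap.add_apply, LinearMap.coe_sum, Finset.sum_apply, inftyFunctional_cuspMatrix_apply N]

end RayDual

/-! ### `T_p^∨` on a shift difference `Φ(x + 1/3) − Φ(x)`, `p ≡ 1 (mod 3)` -/

section HeckeShift

variable (N : ℕ) [NeZero N] (h9 : 3 ^ 2 ∣ N) {p : ℕ} [NeZero p] (hp : p.Prime)

/-- **Re-indexing the Hecke sum of a shifted cusp**: for `p = 3m + 1`,
`Σ_{j<p} Φ((x + 1/3 + j)/p) = Σ_{j<p} Φ((x + j)/p + 1/3)` — since `(x + 1/3 + j)/p = (x + (j − m))/p + 1/3` and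
`j ↦ j − m (mod p)` permutes the residues, the wrap-around changing the cusp by an integer (`Φ(r + n) = Φ(r)`).  This is
`[1, j; 0, p]·t = t·[1, 1; 0, 1]^ε·[1, j − m (mod p); 0, p]` on cusps. [cite: CremonaAlgorithms1997, §2.4 (2.4.1)–(2.4.2)] -/
theorem sum_inftyFunctional_cuspMatrix_add_third_div (hp1 : p % 3 = 1) (x : ℚ) :
    ∑ j : Fin p, (inftyFunctional (cuspMatrix ((x + 1 / 3 + ((j : ℕ) : ℤ)) / p)) : Module.Dual ℂ (CuspForm (Gamma0 N) 2)) =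
      ∑ j : Fin p, (inftyFunctional (cuspMatrix ((x + ((j : ℕ) : ℤ)) / p + 1 / 3)) : Module.Dual ℂ (CuspForm (Gamma0 N) 2)) := by
  have hp0 : 0 < p := NeZero.pos p
  -- `m = (p - 1)/3`, as an element of `Fin p`
  set m : ℕ := p / 3 with hm
  have hpm : p = 3 * m + 1 := by omega
  have hmlt : m < p := by omega
  let mF : Fin p := ⟨m, hmlt⟩
  -- re-index the left sum along `j ↦ j + mF`
  rw [← Equiv.sum_comp (Equiv.addRight mF)
    (fun j : Fin p ↦ (inftyFunctional (cuspMatrix ((x + 1 / 3 + ((j : ℕ) : ℤ)) / p)) : Module.Dual ℂ (CuspForm (Gamma0 N) 2)))]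
  refine Finset.sum_congr rfl fun j _ ↦ ?_
  simp only [Equiv.coe_addRight]
  -- `((j + mF : Fin p) : ℕ) + p·q = j + m`
  obtain ⟨q, hq⟩ : ∃ q : ℕ, ((j + mF : Fin p) : ℕ) + p * q = (j : ℕ) + m :=
    ⟨((j : ℕ) + m) / p, by rw [Fin.val_add]; exact Nat.mod_add_div _ _⟩
  have hvalQ : ((((j + mF : Fin p) : ℕ) : ℤ) : ℚ) = ((j : ℕ) : ℚ) + m - (p : ℚ) * q := by
    have h := congrArg (Nat.cast : ℕ → ℚ) hq
    push_cast at h ⊢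
    linarith
  -- the two cusps differ by the integer `-q`
  have key : (x + 1 / 3 + ((((j + mF : Fin p) : ℕ) : ℤ) : ℚ)) / p =
      (x + (((j : ℕ) : ℤ) : ℚ)) / p + 1 / 3 + ((-(q : ℤ) : ℤ) : ℚ) := by
    rw [hvalQ]
    have hp' : (p : ℚ) ≠ 0 := by exact_mod_cast hp0.ne'
    have hpq : (p : ℚ) = 3 * m + 1 := by exact_mod_cast hpm
    push_cast
    field_simp
    rw [hpq]
    ring
  rw [key, inftyFunctional_cuspMatrix_add_intCast]

/-- **Telescoping**: `Φ(r + p/3) − Φ(r) = Σ_{k<p} (t_* − 1) t_*ᵏ Φ(r)` (`t_*ᵏΦ(r) = Φ(r + k/3)`). [cite: Harrison2011X0108, §2] -/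
theorem inftyFunctional_cuspMatrix_add_sub_eq_sum (r : ℚ) (n : ℕ) :
    (inftyFunctional (cuspMatrix (r + n / 3)) : Module.Dual ℂ (CuspForm (Gamma0 N) 2)) - (inftyFunctional (cuspMatrix r) : Module.Dual ℂ (CuspForm (Gamma0 N) 2)) =
      ∑ k ∈ Finset.range n, (shiftDual N h9 - 1) ((shiftDual N h9 ^ k) ((inftyFunctional (cuspMatrix r) : Module.Dual ℂ (CuspForm (Gamma0 N) 2)))) := by
  induction n with
  | zero => simp
  | succ n ih =>
    rw [Finset.sum_range_succ, ← ih, LinearMap.sub_apply, Module.End.one_apply, ← Module.End.mul_apply,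
      ← pow_succ', shiftDual_pow_inftyFunctional_cuspMatrix, shiftDual_pow_inftyFunctional_cuspMatrix]
    push_cast
    abel

include hp in
/-- **`T_p^∨` on a shift difference** (`p ∤ N` prime, `p ≡ 1 (mod 3)`):
`T_p^∨(Φ(x + 1/3) − Φ(x)) = (t_* − 1)[Σ_{j<p} Φ((x + j)/p) + Σ_{k<p} t_*ᵏ Φ(px)]`.
[cite: CremonaAlgorithms1997, §2.4 (2.4.1)–(2.4.2)] -/
theorem dualMap_heckeT_shiftDual_sub_inftyFunctional (hpN : ¬ p ∣ N) (hp1 : p % 3 = 1) (x : ℚ) :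
    (heckeT (Gamma0 N) 2 p).dualMap ((inftyFunctional (cuspMatrix (x + 1 / 3)) : Module.Dual ℂ (CuspForm (Gamma0 N) 2)) - (inftyFunctional (cuspMatrix x) : Module.Dual ℂ (CuspForm (Gamma0 N) 2))) =
      (shiftDual N h9 - 1) (∑ j : Fin p, (inftyFunctional (cuspMatrix ((x + ((j : ℕ) : ℤ)) / p)) : Module.Dual ℂ (CuspForm (Gamma0 N) 2)) +
        ∑ k ∈ Finset.range p, (shiftDual N h9 ^ k) ((inftyFunctional (cuspMatrix (p * x)) : Module.Dual ℂ (CuspForm (Gamma0 N) 2)))) := by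
  rw [map_sub, dualMap_heckeT_inftyFunctional_cuspMatrix N hp hpN, dualMap_heckeT_inftyFunctional_cuspMatrix N hp hpN, sum_inftyFunctional_cuspMatrix_add_third_div N hp1,
    map_add, map_sum, map_sum]
  have e1 : (p : ℚ) * (x + 1 / 3) = p * x + (p : ℕ) / 3 := by ring
  rw [e1]
  have e2 : (inftyFunctional (cuspMatrix ((p : ℚ) * x + (p : ℕ) / 3)) : Module.Dual ℂ (CuspForm (Gamma0 N) 2)) - (inftyFunctional (cuspMatrix (p * x)) : Module.Dual ℂ (CuspForm (Gamma0 N) 2)) =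
      ∑ k ∈ Finset.range p, (shiftDual N h9 - 1) ((shiftDual N h9 ^ k) ((inftyFunctional (cuspMatrix (p * x)) : Module.Dual ℂ (CuspForm (Gamma0 N) 2)))) :=
    inftyFunctional_cuspMatrix_add_sub_eq_sum N h9 (p * x) p
  have e3 : ∀ j : Fin p, (inftyFunctional (cuspMatrix ((x + ((j : ℕ) : ℤ)) / p + 1 / 3)) : Module.Dual ℂ (CuspForm (Gamma0 N) 2)) - (inftyFunctional (cuspMatrix ((x + ((j : ℕ) : ℤ)) / p)) : Module.Dual ℂ (CuspForm (Gamma0 N) 2)) =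
      (shiftDual N h9 - 1) ((inftyFunctional (cuspMatrix ((x + ((j : ℕ) : ℤ)) / p)) : Module.Dual ℂ (CuspForm (Gamma0 N) 2))) := fun j ↦ by
    rw [LinearMap.sub_apply, Module.End.one_apply, shiftDual_inftyFunctional_cuspMatrix]
  calc ∑ j : Fin p, (inftyFunctional (cuspMatrix ((x + ((j : ℕ) : ℤ)) / p + 1 / 3)) : Module.Dual ℂ (CuspForm (Gamma0 N) 2)) + (inftyFunctional (cuspMatrix ((p : ℚ) * x + (p : ℕ) / 3)) : Module.Dual ℂ (CuspForm (Gamma0 N) 2)) -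
        (∑ j : Fin p, (inftyFunctional (cuspMatrix ((x + ((j : ℕ) : ℤ)) / p)) : Module.Dual ℂ (CuspForm (Gamma0 N) 2)) + (inftyFunctional (cuspMatrix (p * x)) : Module.Dual ℂ (CuspForm (Gamma0 N) 2)))
      = ∑ j : Fin p, ((inftyFunctional (cuspMatrix ((x + ((j : ℕ) : ℤ)) / p + 1 / 3)) : Module.Dual ℂ (CuspForm (Gamma0 N) 2)) - (inftyFunctional (cuspMatrix ((x + ((j : ℕ) : ℤ)) / p)) : Module.Dual ℂ (CuspForm (Gamma0 N) 2))) +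
          ((inftyFunctional (cuspMatrix ((p : ℚ) * x + (p : ℕ) / 3)) : Module.Dual ℂ (CuspForm (Gamma0 N) 2)) - (inftyFunctional (cuspMatrix (p * x)) : Module.Dual ℂ (CuspForm (Gamma0 N) 2))) := by
        rw [Finset.sum_sub_distrib]; abel
    _ = _ := by
        rw [e2, Finset.sum_congr rfl fun j _ ↦ e3 j]

end HeckeShift

/-! ### The fixed cusp of a parabolic `t⁻¹γ` and the symbol `{∞, γ∞} = Φ(x + 1/3) − Φ(x)` -/

section FixedCusp

variable (N : ℕ) [NeZero N]

omit [NeZero N] in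
/-- **The fixed cusp of a parabolic element of `t⁻¹Γ₀(N)`**.  For `γ = (a b; c d) ∈ Γ₀(N)` with
`(3(a + d) − c)² = 36` (i.e. `tr(t⁻¹γ) = ±2`) and `c ≠ 0`, the cusp `x = (3a − c − 3d)/(6c)` satisfies `cx + d = ±1 ≠ 0`
and `γx = (ax + b)/(cx + d) = x + 1/3`: it is the fixed point of the parabolic `e = t⁻¹γ`, so `γx = t(ex) = tx`.
[cite: Shimura1971, §1.3] -/
theorem moebius_fixedCusp_eq (γ : Gamma0 N)
    (hs : (3 * ((γ : SL(2, ℤ)) 0 0 + (γ : SL(2, ℤ)) 1 1) - (γ : SL(2, ℤ)) 1 0) ^ 2 = 36)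
    (hc : (γ : SL(2, ℤ)) 1 0 ≠ 0) :
    ((γ : SL(2, ℤ)) 1 0 : ℚ) * ((3 * (γ : SL(2, ℤ)) 0 0 - (γ : SL(2, ℤ)) 1 0 - 3 * (γ : SL(2, ℤ)) 1 1 : ℚ) /
        (6 * (γ : SL(2, ℤ)) 1 0)) + ((γ : SL(2, ℤ)) 1 1 : ℚ) ≠ 0 ∧
    (((γ : SL(2, ℤ)) 0 0 : ℚ) * ((3 * (γ : SL(2, ℤ)) 0 0 - (γ : SL(2, ℤ)) 1 0 - 3 * (γ : SL(2, ℤ)) 1 1 : ℚ) /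
        (6 * (γ : SL(2, ℤ)) 1 0)) + ((γ : SL(2, ℤ)) 0 1 : ℚ)) /
      (((γ : SL(2, ℤ)) 1 0 : ℚ) * ((3 * (γ : SL(2, ℤ)) 0 0 - (γ : SL(2, ℤ)) 1 0 - 3 * (γ : SL(2, ℤ)) 1 1 : ℚ) /
        (6 * (γ : SL(2, ℤ)) 1 0)) + ((γ : SL(2, ℤ)) 1 1 : ℚ)) =
      (3 * (γ : SL(2, ℤ)) 0 0 - (γ : SL(2, ℤ)) 1 0 - 3 * (γ : SL(2, ℤ)) 1 1 : ℚ) / (6 * (γ : SL(2, ℤ)) 1 0) + 1 / 3 := by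
  -- abbreviations `a b c d`, `s = 3(a + d) − c`
  set a : ℚ := ((γ : SL(2, ℤ)) 0 0 : ℚ) with ha
  set b : ℚ := ((γ : SL(2, ℤ)) 0 1 : ℚ) with hb
  set c : ℚ := ((γ : SL(2, ℤ)) 1 0 : ℚ) with hc'
  set d : ℚ := ((γ : SL(2, ℤ)) 1 1 : ℚ) with hd
  have hdet : a * d - b * c = 1 := by
    have h := Matrix.det_fin_two (γ : Matrix (Fin 2) (Fin 2) ℤ)
    rw [Matrix.SpecialLinearGroup.det_coe] at h
    have h' : ((γ : SL(2, ℤ)) 0 0 : ℚ) * (γ : SL(2, ℤ)) 1 1 - (γ : SL(2, ℤ)) 0 1 * (γ : SL(2, ℤ)) 1 0 = 1 := by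
      exact_mod_cast h.symm
    simpa [ha, hb, hc', hd] using h'
  have hsq : (3 * (a + d) - c) ^ 2 = 36 := by
    have h' : ((3 * ((γ : SL(2, ℤ)) 0 0 + (γ : SL(2, ℤ)) 1 1) - (γ : SL(2, ℤ)) 1 0 : ℤ) : ℚ) ^ 2 = 36 := by
      exact_mod_cast hs
    push_cast at h'
    simpa [ha, hc', hd] using h'
  have hcq : c ≠ 0 := by
    rw [hc']
    exact_mod_cast hc
  have hs0 : 3 * (a + d) - c ≠ 0 := by
    intro h0
    rw [h0] at hsq
    norm_num at hsq
  -- `cx + d = s/6`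
  have hden : c * ((3 * a - c - 3 * d) / (6 * c)) + d = (3 * (a + d) - c) / 6 := by
    field_simp
    ring
  have hden0 : c * ((3 * a - c - 3 * d) / (6 * c)) + d ≠ 0 := by
    rw [hden]
    exact div_ne_zero hs0 (by norm_num)
  refine ⟨hden0, ?_⟩
  set X : ℚ := (3 * a - c - 3 * d) / (6 * c) with hX
  have key : (a * X + b - (X + 1 / 3) * (c * X + d)) * (36 * c) =
      ((3 * (a + d) - c) ^ 2 - 36) - 36 * (a * d - b * c - 1) := by
    rw [hX]
    field_simp
    ring
  have key0 : (a * X + b - (X + 1 / 3) * (c * X + d)) * (36 * c) = 0 := by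
    rw [key, hsq, hdet]
    ring
  have hnum : a * X + b = (X + 1 / 3) * (c * X + d) := by
    have h36 : (36 : ℚ) * c ≠ 0 := mul_ne_zero (by norm_num) hcq
    have h0 := (mul_eq_zero.mp key0).resolve_right h36
    linear_combination h0
  rw [div_eq_iff hden0]
  exact hnum

/-- **The symbol of a parabolic-type `γ` is a shift difference at its fixed cusp**: for `γ ∈ Γ₀(N)` with
`(3(a + d) − c)² = 36` and `c ≠ 0`, `{∞, γ∞} = Φ(x + 1/3) − Φ(x)` with `x = (3a − c − 3d)/(6c)` — by Manin's relation
`Φ(γx) = {∞, γ∞} + Φ(x)` and `γx = x + 1/3`.  In `H₁(X₀(N), ℤ)` this is the loop `{x, tx}` through the `t`-fixed cusp `x̄`.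
[cite: Manin1972, §1.5 and Prop. 1.4] -/
theorem periodFunctional_eq_inftyFunctional_sub_of_parabolic (γ : Gamma0 N)
    (hs : (3 * ((γ : SL(2, ℤ)) 0 0 + (γ : SL(2, ℤ)) 1 1) - (γ : SL(2, ℤ)) 1 0) ^ 2 = 36)
    (hc : (γ : SL(2, ℤ)) 1 0 ≠ 0) :
    periodFunctional N γ =
      (inftyFunctional (cuspMatrix ((3 * (γ : SL(2, ℤ)) 0 0 - (γ : SL(2, ℤ)) 1 0 - 3 * (γ : SL(2, ℤ)) 1 1 : ℚ) / (6 * (γ : SL(2, ℤ)) 1 0) + 1 / 3)) : Module.Dual ℂ (CuspForm (Gamma0 N) 2)) -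
      (inftyFunctional (cuspMatrix ((3 * (γ : SL(2, ℤ)) 0 0 - (γ : SL(2, ℤ)) 1 0 - 3 * (γ : SL(2, ℤ)) 1 1 : ℚ) / (6 * (γ : SL(2, ℤ)) 1 0))) : Module.Dual ℂ (CuspForm (Gamma0 N) 2)) := by
  obtain ⟨hden, heq⟩ := moebius_fixedCusp_eq N γ hs hc
  have h := inftyFunctional_cuspMatrix_moebius N γ _ hden
  rw [heq] at h
  rw [h, add_sub_cancel_right]

end FixedCusp

/-! ### Cusp transport: cusps `x/y`, `x'/y'` with `y' ≡ y (mod N)`, `x' ≡ x (mod gcd(y, N))` are `Γ₀(N)`-equivalent -/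

section CuspTransport

variable (N : ℕ) [NeZero N]

omit [NeZero N] in
/-- **Equivalence of cusps under `Γ₀(N)`** (Cremona Prop. 2.2.3 with `u = 1`; vector form): if `(x, y)` and `(x', y')` are
primitive with `y' ≡ y (mod N)` and `x' ≡ x (mod gcd(y, N))`, some `β ∈ Γ₀(N)` maps `(x, y)` to `(x', y')`.  Proof:
`β = g'Tⁿg⁻¹` for `g = (x −v; y u)`, `g' = (x' −v'; y' u')` (`ux + vy = 1 = u'x' + v'y'`); its lower-left entry is
`y(u − u' − ny) (mod N)`, and `ny ≡ u − u' (mod N/gcd(y, N))` is solvable because `u ≡ u' (mod gcd(y, N/gcd(y, N)))`.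
[cite: CremonaAlgorithms1997, Prop. 2.2.3] -/
theorem exists_gamma0_mulVec_eq {x y x' y' : ℤ} (hxy : IsCoprime x y) (hxy' : IsCoprime x' y')
    (hN : (N : ℤ) ∣ y' - y) (hg : (Int.gcd y N : ℤ) ∣ x' - x) :
    ∃ β : Gamma0 N, (β : SL(2, ℤ)) 0 0 * x + (β : SL(2, ℤ)) 0 1 * y = x' ∧
      (β : SL(2, ℤ)) 1 0 * x + (β : SL(2, ℤ)) 1 1 * y = y' := by
  obtain ⟨u, v, huv⟩ := hxy
  obtain ⟨u', v', huv'⟩ := hxy'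
  obtain ⟨k, hk⟩ := hN
  -- `g₁ = gcd(y, N)`, `y = g₁ y₁`, `N = g₁ N₁`
  set g₁ : ℤ := (Int.gcd y N : ℤ) with hg₁
  obtain ⟨y₁, hy₁⟩ : g₁ ∣ y := Int.gcd_dvd_left y N
  obtain ⟨N₁, hN₁⟩ : g₁ ∣ (N : ℤ) := Int.gcd_dvd_right y N
  -- `q = gcd(y, N₁)` divides `u − u'`
  set q : ℤ := (Int.gcd y N₁ : ℤ) with hq
  have hqy : q ∣ y := Int.gcd_dvd_left y N₁
  have hqN₁ : q ∣ N₁ := Int.gcd_dvd_right y N₁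
  have hqN : q ∣ (N : ℤ) := by rw [hN₁]; exact Dvd.dvd.mul_left hqN₁ g₁
  have hqg : q ∣ g₁ := by
    rw [hg₁, Int.gcd]
    exact Int.natCast_dvd_natCast.mpr (Nat.dvd_gcd (Int.natAbs_dvd_natAbs.mpr hqy |>.trans (by simp))
      (Int.natAbs_dvd_natAbs.mpr hqN |>.trans (by simp)))
  have hqy' : q ∣ y' := by
    have e : y' = y + N * k := by linear_combination hk
    rw [e]
    exact dvd_add hqy (Dvd.dvd.mul_right hqN k)
  have hqx : q ∣ x' - x := hqg.trans hg
  have hquu : q ∣ u - u' := by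
    -- `u − u' = u(u'x' + v'y') − u'(ux + vy) = uu'(x' − x) + uv'y' − u'vy`
    have e : u - u' = u * u' * (x' - x) + u * v' * y' - u' * v * y := by
      linear_combination (-u) * huv' + u' * huv
    rw [e]
    exact dvd_sub (dvd_add (Dvd.dvd.mul_left hqx _) (Dvd.dvd.mul_left hqy' _)) (Dvd.dvd.mul_left hqy _)
  obtain ⟨w, hw⟩ := hquu
  -- Bezout for `q = gcd(y, N₁)`: `n y ≡ u − u' (mod N₁)`
  set gA : ℤ := Int.gcdA y N₁ with hgA
  set gB : ℤ := Int.gcdB y N₁ with hgB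
  have hbez : q = y * gA + N₁ * gB := Int.gcd_eq_gcd_ab y N₁
  set n : ℤ := gA * w with hn
  -- the matrix `β = g' Tⁿ g⁻¹`
  let A : Matrix (Fin 2) (Fin 2) ℤ :=
    !![x' * u - n * x' * y + v' * y, x' * v + n * x * x' - v' * x;
      y' * u - n * y * y' - u' * y, y' * v + n * x * y' + u' * x]
  have hA : A.det = 1 := by
    rw [Matrix.det_fin_two_of]
    linear_combination (u * x + v * y) * huv' + huv
  have hA10 : (N : ℤ) ∣ (y' * u - n * y * y' - u' * y) := by
    -- `y'u − n y y' − u'y = y(u − u' − n y) + N k (u − n y)` and `u − u' − n y = N₁ β' w`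
    have e1 : y' * u - n * y * y' - u' * y = y * (u - u' - n * y) + N * k * (u - n * y) := by
      linear_combination (u - n * y) * hk
    have e2 : u - u' - n * y = N₁ * (gB * w) := by
      rw [hn]
      linear_combination hw + w * hbez
    rw [e1, e2]
    refine dvd_add ?_ (Dvd.dvd.mul_right (Dvd.dvd.mul_right (dvd_refl _) k) _)
    have e3 : y * (N₁ * (gB * w)) = (N : ℤ) * (y₁ * gB * w) := by
      rw [hN₁, hy₁]
      ring
    rw [e3]
    exact Dvd.intro _ rfl
  refine ⟨⟨⟨A, hA⟩, ?_⟩, ?_, ?_⟩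
  · rw [Gamma0_mem]
    change (((y' * u - n * y * y' - u' * y : ℤ)) : ZMod N) = 0
    exact (ZMod.intCast_zmod_eq_zero_iff_dvd _ N).mpr hA10
  · change (x' * u - n * x' * y + v' * y) * x + (x' * v + n * x * x' - v' * x) * y = x'
    linear_combination x' * huv
  · change (y' * u - n * y * y' - u' * y) * x + (y' * v + n * x * y' + u' * x) * y = y'
    linear_combination y' * huv

omit [NeZero N] in
/-- Cusp transport read on the rational cusps: under the hypotheses of `exists_gamma0_mulVec_eq` with `y, y' ≠ 0`, some
`β = (a b; c d) ∈ Γ₀(N)` has `c(x/y) + d ≠ 0` and `(a(x/y) + b)/(c(x/y) + d) = x'/y'`. [cite: CremonaAlgorithms1997, Prop. 2.2.3] -/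
theorem exists_gamma0_moebius_eq {x y x' y' : ℤ} (hxy : IsCoprime x y) (hxy' : IsCoprime x' y') (hy : y ≠ 0)
    (hy' : y' ≠ 0) (hN : (N : ℤ) ∣ y' - y) (hg : (Int.gcd y N : ℤ) ∣ x' - x) :
    ∃ β : Gamma0 N, ((β : SL(2, ℤ)) 1 0 : ℚ) * ((x : ℚ) / y) + ((β : SL(2, ℤ)) 1 1 : ℚ) ≠ 0 ∧
      (((β : SL(2, ℤ)) 0 0 : ℚ) * ((x : ℚ) / y) + ((β : SL(2, ℤ)) 0 1 : ℚ)) /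
        (((β : SL(2, ℤ)) 1 0 : ℚ) * ((x : ℚ) / y) + ((β : SL(2, ℤ)) 1 1 : ℚ)) = (x' : ℚ) / y' := by
  obtain ⟨β, h0, h1⟩ := exists_gamma0_mulVec_eq N hxy hxy' hN hg
  have hyq : (y : ℚ) ≠ 0 := by exact_mod_cast hy
  have hyq' : (y' : ℚ) ≠ 0 := by exact_mod_cast hy'
  have h0q : ((β : SL(2, ℤ)) 0 0 : ℚ) * x + ((β : SL(2, ℤ)) 0 1 : ℚ) * y = x' := by exact_mod_cast h0
  have h1q : ((β : SL(2, ℤ)) 1 0 : ℚ) * x + ((β : SL(2, ℤ)) 1 1 : ℚ) * y = y' := by exact_mod_cast h1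
  have hden : ((β : SL(2, ℤ)) 1 0 : ℚ) * ((x : ℚ) / y) + ((β : SL(2, ℤ)) 1 1 : ℚ) = (y' : ℚ) / y := by
    field_simp
    linear_combination h1q
  have hnum : ((β : SL(2, ℤ)) 0 0 : ℚ) * ((x : ℚ) / y) + ((β : SL(2, ℤ)) 0 1 : ℚ) = (x' : ℚ) / y := by
    field_simp
    linear_combination h0q
  refine ⟨β, ?_, ?_⟩
  · rw [hden]
    exact div_ne_zero hyq' hyq
  · rw [hden, hnum, div_div_div_cancel_right₀ hyq]

end CuspTransport

/-! ### The Hecke neighbours `(r + j)/p`, `pr` of a cusp `r` are `Γ₀(N)`-translates of `r` when `p ≡ 1 (mod N)` -/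

section Neighbours

variable (N : ℕ) {p : ℕ} (hp : p.Prime) (hpN : (N : ℤ) ∣ (p : ℤ) - 1)
include hp hpN

/-- **The neighbour `(r + j)/p` of a cusp `r` is a `Γ₀(N)`-translate of `r`** (`p` prime, `p ≡ 1 (mod N)`): with
`r = x/y` in lowest terms, `(r + j)/p = (x + jy)/(py)` has lowest terms `(x + jy, py)` or `((x + jy)/p, y)`, in both cases
congruent to `(x, y)` in the sense of `exists_gamma0_mulVec_eq` (`py ≡ y (mod N)`). [cite: CremonaAlgorithms1997, Prop. 2.2.3] -/
theorem exists_gamma0_moebius_eq_add_div (r : ℚ) (j : ℤ) :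
    ∃ β : Gamma0 N, ((β : SL(2, ℤ)) 1 0 : ℚ) * r + ((β : SL(2, ℤ)) 1 1 : ℚ) ≠ 0 ∧
      (((β : SL(2, ℤ)) 0 0 : ℚ) * r + ((β : SL(2, ℤ)) 0 1 : ℚ)) /
        (((β : SL(2, ℤ)) 1 0 : ℚ) * r + ((β : SL(2, ℤ)) 1 1 : ℚ)) = (r + j) / p := by
  have hp0 : (p : ℤ) ≠ 0 := by exact_mod_cast hp.ne_zero
  have hpq : (p : ℚ) ≠ 0 := by exact_mod_cast hp.ne_zero
  have hpr : Prime (p : ℤ) := Nat.prime_iff_prime_int.mp hp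
  set x : ℤ := r.num with hx
  set y : ℤ := (r.den : ℤ) with hy
  have hy0 : y ≠ 0 := by rw [hy]; exact_mod_cast r.den_nz
  have hyq : (y : ℚ) ≠ 0 := by exact_mod_cast hy0
  have hr : (x : ℚ) / y = r := by rw [hx, hy, Int.cast_natCast]; exact Rat.num_div_den r
  have hxy : IsCoprime x y := Rat.isCoprime_num_den r
  have hgy : (Int.gcd y N : ℤ) ∣ y := Int.gcd_dvd_left y N
  have hgN : (Int.gcd y N : ℤ) ∣ (N : ℤ) := Int.gcd_dvd_right y N
  -- the target cusp `(x + jy)/(py)`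
  have htarget : (r + j) / p = ((x + j * y : ℤ) : ℚ) / ((p * y : ℤ) : ℚ) := by
    rw [← hr]
    push_cast
    field_simp
  by_cases hdiv : (p : ℤ) ∣ x + j * y
  · -- lowest terms `((x + jy)/p, y)`
    obtain ⟨x', hx'⟩ := hdiv
    have hcop : IsCoprime x' y :=
      (IsCoprime.of_mul_left_right (hx' ▸ hxy.add_mul_right_left j) : IsCoprime x' y)
    have hcong : (Int.gcd y N : ℤ) ∣ x' - x := by
      -- `p(x' − x) = jy − (p − 1)x` is divisible by `gcd(y, N)`, and `gcd(p, N) = 1`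
      have h1 : (Int.gcd y N : ℤ) ∣ (p : ℤ) * (x' - x) := by
        have e : (p : ℤ) * (x' - x) = j * y - ((p : ℤ) - 1) * x := by linear_combination -hx'
        rw [e]
        exact dvd_sub (Dvd.dvd.mul_left hgy j) (Dvd.dvd.mul_right (hgN.trans hpN) x)
      have hcp : IsCoprime (Int.gcd y N : ℤ) (p : ℤ) := by
        obtain ⟨c, hc⟩ := hgN.trans hpN
        exact ⟨-c, 1, by linear_combination hc⟩
      exact hcp.dvd_of_dvd_mul_left h1
    obtain ⟨β, hβ0, hβ⟩ := exists_gamma0_moebius_eq N hxy hcop hy0 hy0 (by simp) hcong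
    refine ⟨β, by rwa [← hr], ?_⟩
    rw [htarget, ← hr, hβ, hx']
    push_cast
    field_simp
  · -- lowest terms `(x + jy, py)`
    have hcop : IsCoprime (x + j * y) ((p : ℤ) * y) :=
      IsCoprime.mul_right ((Prime.coprime_iff_not_dvd hpr).mpr hdiv).symm (hxy.add_mul_right_left j)
    have hpy0 : (p : ℤ) * y ≠ 0 := mul_ne_zero hp0 hy0
    have hN' : (N : ℤ) ∣ (p : ℤ) * y - y := by
      have e : (p : ℤ) * y - y = ((p : ℤ) - 1) * y := by ring
      rw [e]
      exact Dvd.dvd.mul_right hpN y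
    have hcong : (Int.gcd y N : ℤ) ∣ x + j * y - x := by
      have e : x + j * y - x = j * y := by ring
      rw [e]
      exact Dvd.dvd.mul_left hgy j
    obtain ⟨β, hβ0, hβ⟩ := exists_gamma0_moebius_eq N hxy hcop hy0 hpy0 hN' hcong
    refine ⟨β, by rwa [← hr], ?_⟩
    rw [htarget, ← hr, hβ]

/-- **The neighbour `pr` of a cusp `r` is a `Γ₀(N)`-translate of `r`** (`p` prime, `p ≡ 1 (mod N)`): `pr = px/y` has
lowest terms `(px, y)` or `(x, y/p)`, and `y/p ≡ y (mod N)` as `N ∣ p − 1`. [cite: CremonaAlgorithms1997, Prop. 2.2.3] -/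
theorem exists_gamma0_moebius_eq_mul (r : ℚ) :
    ∃ β : Gamma0 N, ((β : SL(2, ℤ)) 1 0 : ℚ) * r + ((β : SL(2, ℤ)) 1 1 : ℚ) ≠ 0 ∧
      (((β : SL(2, ℤ)) 0 0 : ℚ) * r + ((β : SL(2, ℤ)) 0 1 : ℚ)) /
        (((β : SL(2, ℤ)) 1 0 : ℚ) * r + ((β : SL(2, ℤ)) 1 1 : ℚ)) = p * r := by
  have hp0 : (p : ℤ) ≠ 0 := by exact_mod_cast hp.ne_zero
  have hpq : (p : ℚ) ≠ 0 := by exact_mod_cast hp.ne_zero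
  have hpr : Prime (p : ℤ) := Nat.prime_iff_prime_int.mp hp
  set x : ℤ := r.num with hx
  set y : ℤ := (r.den : ℤ) with hy
  have hy0 : y ≠ 0 := by rw [hy]; exact_mod_cast r.den_nz
  have hyq : (y : ℚ) ≠ 0 := by exact_mod_cast hy0
  have hr : (x : ℚ) / y = r := by rw [hx, hy, Int.cast_natCast]; exact Rat.num_div_den r
  have hxy : IsCoprime x y := Rat.isCoprime_num_den r
  by_cases hdiv : (p : ℤ) ∣ y
  · -- lowest terms `(x, y/p)`
    obtain ⟨y', hy'⟩ := hdiv
    have hy'0 : y' ≠ 0 := by rintro rfl; exact hy0 (by rw [hy', mul_zero])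
    have hcop : IsCoprime x y' := IsCoprime.of_mul_right_right (hy' ▸ hxy)
    have hN' : (N : ℤ) ∣ y' - y := by
      have e : y' - y = -(((p : ℤ) - 1) * y') := by rw [hy']; ring
      rw [e]
      exact (Dvd.dvd.mul_right hpN y').neg_right
    obtain ⟨β, hβ0, hβ⟩ := exists_gamma0_moebius_eq N hxy hcop hy0 hy'0 hN' (by simp)
    refine ⟨β, by rwa [← hr], ?_⟩
    rw [← hr, hβ, hy']
    have hy'q : (y' : ℚ) ≠ 0 := by exact_mod_cast hy'0
    push_cast
    field_simp
  · -- lowest terms `(px, y)`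
    have hcop : IsCoprime ((p : ℤ) * x) y :=
      IsCoprime.mul_left ((Prime.coprime_iff_not_dvd hpr).mpr hdiv) hxy
    have hgy : (Int.gcd y N : ℤ) ∣ y := Int.gcd_dvd_left y N
    have hgN : (Int.gcd y N : ℤ) ∣ (N : ℤ) := Int.gcd_dvd_right y N
    have hcong : (Int.gcd y N : ℤ) ∣ (p : ℤ) * x - x := by
      have e : (p : ℤ) * x - x = ((p : ℤ) - 1) * x := by ring
      rw [e]
      exact Dvd.dvd.mul_right (hgN.trans hpN) x
    obtain ⟨β, hβ0, hβ⟩ := exists_gamma0_moebius_eq N hxy hcop hy0 hy0 (by simp) hcong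
    refine ⟨β, by rwa [← hr], ?_⟩
    rw [← hr, hβ]
    push_cast
    field_simp

end Neighbours

/-! ### Assembly: `(T_p − 2)·{∞, γ∞} ∈ (t − 1)Λ` for parabolic-type `γ` and `p ≡ 1 (mod N)` -/

section Parabolic

variable (N : ℕ) [NeZero N] (h9 : 3 ^ 2 ∣ N)

/-- `t_*ᵏ` on `Λ` is `t_*ᵏ` on the underlying functionals (plumbing; the sibling `CuspidalHomologyHeckeTransfer` has the
applied form under the same name). [folklore] -/
private theorem coe_shiftInt_pow_eq (k : ℕ) (z : periodHomologyHecke N) :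
    (((shiftInt N h9 ^ k) z : periodHomologyHecke N) : Module.Dual ℂ (CuspForm (Gamma0 N) 2)) =
      (shiftDual N h9 ^ k) (z : Module.Dual ℂ (CuspForm (Gamma0 N) 2)) := by
  induction k with
  | zero => simp
  | succ k ih => rw [pow_succ', Module.End.mul_apply, coe_shiftInt, ih, pow_succ', Module.End.mul_apply]

/-- `(t_* − 1) Σ_{k<n} t_*ᵏ φ = (t_*ⁿ − 1) φ` (geometric sum in `End(S₂^∨)`; plumbing). [folklore] -/
private theorem shiftDual_sub_one_sum_pow_apply (n : ℕ) (φ : Module.Dual ℂ (CuspForm (Gamma0 N) 2)) :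
    (shiftDual N h9 - 1) (∑ k ∈ Finset.range n, (shiftDual N h9 ^ k) φ) = (shiftDual N h9 ^ n - 1) φ := by
  rw [← LinearMap.sum_apply, ← Module.End.mul_apply, mul_geom_sum]

/-- `t_*ᵖ = t_*` on `S₂(Γ₀(N))^∨` for `p ≡ 1 (mod 3)` (`t_*³ = 1`). [cite: Harrison2011X0108, §2] -/
theorem shiftDual_pow_eq_of_mod_three_eq_one {p : ℕ} (hp1 : p % 3 = 1) : shiftDual N h9 ^ p = shiftDual N h9 := by
  rw [← Nat.div_add_mod p 3, hp1, pow_add, pow_one, pow_mul, shiftDual_pow_three, one_pow, one_mul]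

/-- **A parabolic-type symbol is in the Prym lattice**: for `γ ∈ Γ₀(N)` with `(3(a + d) − c)² = 36`, `{∞, γ∞} ∈ Λ_P`
(`Nm·(t_* − 1)Φ(x) = (t_*³ − 1)Φ(x) = 0`), hence `3·{∞, γ∞} ∈ (t − 1)Λ`. [cite: Harrison2011X0108, §2] -/
theorem symbolInt_mem_prymLattice_of_parabolic (γ : Gamma0 N)
    (hs : (3 * ((γ : SL(2, ℤ)) 0 0 + (γ : SL(2, ℤ)) 1 1) - (γ : SL(2, ℤ)) 1 0) ^ 2 = 36) :
    symbolInt N γ ∈ prymLattice N h9 := by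
  rw [mem_prymLattice_iff]
  apply Subtype.ext
  rw [coe_normInt_apply, Submodule.coe_zero, normDual_apply, coe_symbolInt]
  by_cases hc : (γ : SL(2, ℤ)) 1 0 = 0
  · rw [periodFunctional_eq_zero_of_apply_one_zero hc]
    simp
  · rw [periodFunctional_eq_inftyFunctional_sub_of_parabolic N γ hs hc]
    set x : ℚ := (3 * (γ : SL(2, ℤ)) 0 0 - (γ : SL(2, ℤ)) 1 0 - 3 * (γ : SL(2, ℤ)) 1 1 : ℚ) / (6 * (γ : SL(2, ℤ)) 1 0)
      with hx
    simp only [map_sub, shiftDual_inftyFunctional_cuspMatrix]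
    have e1 : x + 1 / 3 + 1 / 3 = x + 2 / 3 := by ring
    have e2 : x + 2 / 3 + 1 / 3 = x + (1 : ℤ) := by push_cast; ring
    have e3 : x + 1 / 3 + 1 / 3 + 1 / 3 = x + (1 : ℤ) := by push_cast; ring
    rw [e1, e2, inftyFunctional_cuspMatrix_add_intCast]
    abel

/-- `(2 : 𝕋_ℤ)` acts on `S₂^∨` as doubling (plumbing for `(T_p − 2)•`). [folklore] -/
private theorem two_heckeRing0_smul (φ : Module.Dual ℂ (CuspForm (Gamma0 N) 2)) :
    (2 : HeckeRing0 N 2) • φ = φ + φ :=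
  two_smul (HeckeRing0 N 2) φ

/-- **E32b for the `t`-fixed CUSPS** (the parabolic case of `FixedPointSymbolHeckeShift`): for `9 ∣ N`, a prime
`p ≡ 1 (mod N)`, `p ≠ 3`, and `γ = (a b; c d) ∈ Γ₀(N)` with `(3(a + d) − c)² = 36` (i.e. `|3(a + d) − c| = 6`:
`t⁻¹γ` parabolic), `(T_p − 2)·{∞, γ∞} ∈ Λ₁ = (t − 1)Λ`.  Proof in the module docstring: `{∞, γ∞} = (t_* − 1)Φ(x)` at the
fixed cusp `x`; `T_p^∨{∞, γ∞} = (t_* − 1)(Z + pΦ(x) + Σ_{k<p} t_*ᵏΦ(x))` with `Z ∈ Λ` (all `p + 1` neighbours of `x` are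
`Γ₀(N)`-translates of `x`); `(t_* − 1)Σ_{k<p}t_*ᵏΦ(x) = (t_* − 1)Φ(x)`; and `(p − 1)·{∞, γ∞} ∈ 3Λ_P ⊆ (t − 1)Λ`.
[cite: CremonaAlgorithms1997, §2.4 (2.4.1)–(2.4.2) and Prop. 2.2.3] [cite: Manin1972, §1.5 and Prop. 1.4] -/
theorem heckeT_sub_two_smul_symbolInt_mem_shiftSubOneLattice_of_parabolic {p : ℕ} (hp : p.Prime) (hp3 : p ≠ 3)
    (hp1N : p ≡ 1 [MOD N]) (γ : Gamma0 N)
    (hs : (3 * ((γ : SL(2, ℤ)) 0 0 + (γ : SL(2, ℤ)) 1 1) - (γ : SL(2, ℤ)) 1 0) ^ 2 = 36) :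
    (HeckeRing0.T N 2 p hp - (2 : HeckeRing0 N 2)) • symbolInt N γ ∈ shiftSubOneLattice N h9 := by
  classical
  haveI : NeZero p := ⟨hp.ne_zero⟩
  -- arithmetic of `p`: `N ∣ p − 1`, `p ∤ N`, `p = 3m + 1`
  have hpN' : (N : ℤ) ∣ (p : ℤ) - 1 := by
    have h := (Nat.ModEq.dvd hp1N.symm)
    simpa using h
  have h3N : (3 : ℤ) ∣ (N : ℤ) := by
    have h : (3 : ℕ) ∣ N := (dvd_pow_self 3 two_ne_zero).trans h9
    exact_mod_cast h
  have hp1 : p % 3 = 1 := by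
    have h31 : (3 : ℤ) ∣ (p : ℤ) - 1 := h3N.trans hpN'
    have h3p : ¬ (3 : ℤ) ∣ (p : ℤ) := by
      intro h
      have : (3 : ℕ) ∣ p := by exact_mod_cast h
      exact hp3 ((Nat.prime_dvd_prime_iff_eq Nat.prime_three hp).mp this).symm
    omega
  have hpN : ¬ p ∣ N := by
    intro h
    have h' : (p : ℤ) ∣ (p : ℤ) - 1 := (Int.natCast_dvd_natCast.mpr h).trans hpN'
    have h1 : (p : ℤ) ∣ 1 := by
      have e : (1 : ℤ) = p - (p - 1) := by ring
      rw [e]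
      exact dvd_sub (dvd_refl _) h'
    exact hp.one_lt.ne' (by exact_mod_cast Int.eq_one_of_dvd_one (by positivity) h1)
  obtain ⟨m, hm⟩ : ∃ m : ℕ, p = 3 * m + 1 := ⟨p / 3, by omega⟩
  -- the degenerate case `c = 0`: `{∞, γ∞} = 0`
  by_cases hc : (γ : SL(2, ℤ)) 1 0 = 0
  · have h0 : symbolInt N γ = 0 := Subtype.ext (by
      rw [coe_symbolInt, periodFunctional_eq_zero_of_apply_one_zero hc, Submodule.coe_zero])
    rw [h0, smul_zero]
    exact Submodule.zero_mem _
  -- the fixed cusp `x` and `δ = {∞, γ∞} = Φ(x + 1/3) − Φ(x) = (t_* − 1)Φ(x)`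
  set x : ℚ := (3 * (γ : SL(2, ℤ)) 0 0 - (γ : SL(2, ℤ)) 1 0 - 3 * (γ : SL(2, ℤ)) 1 1 : ℚ) / (6 * (γ : SL(2, ℤ)) 1 0)
    with hx
  set ψ : Module.Dual ℂ (CuspForm (Gamma0 N) 2) := (inftyFunctional (cuspMatrix x) : Module.Dual ℂ (CuspForm (Gamma0 N) 2)) with hψ
  set t : Module.End ℂ (Module.Dual ℂ (CuspForm (Gamma0 N) 2)) := shiftDual N h9 with ht
  set δ : Module.Dual ℂ (CuspForm (Gamma0 N) 2) := (symbolInt N γ : Module.Dual ℂ (CuspForm (Gamma0 N) 2)) with hδ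
  have hδ' : δ = (inftyFunctional (cuspMatrix (x + 1 / 3)) : Module.Dual ℂ (CuspForm (Gamma0 N) 2)) - ψ := by
    rw [hδ, coe_symbolInt, periodFunctional_eq_inftyFunctional_sub_of_parabolic N γ hs hc]
  have hδt : δ = t ψ - ψ := by rw [hδ', ht, shiftDual_inftyFunctional_cuspMatrix]
  -- the neighbours of `x` are `Γ₀(N)`-translates of `x`
  have hnb : ∀ j : Fin p, ∃ β : Gamma0 N, (inftyFunctional (cuspMatrix ((x + ((j : ℕ) : ℤ)) / p)) : Module.Dual ℂ (CuspForm (Gamma0 N) 2)) = periodFunctional N β + ψ := by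
    intro j
    obtain ⟨β, hβ0, hβ⟩ := exists_gamma0_moebius_eq_add_div N hp hpN' x ((j : ℕ) : ℤ)
    exact ⟨β, by rw [← hβ, inftyFunctional_cuspMatrix_moebius N β x hβ0]⟩
  choose β hβ using hnb
  obtain ⟨β', hβ'0, hβ'⟩ := exists_gamma0_moebius_eq_mul N hp hpN' x
  have hβ'' : (inftyFunctional (cuspMatrix (p * x)) : Module.Dual ℂ (CuspForm (Gamma0 N) 2)) = periodFunctional N β' + ψ := by rw [← hβ', inftyFunctional_cuspMatrix_moebius N β' x hβ'0]
  -- `Z ∈ Λ` and `w ∈ Λ` with `t w − w = 3δ`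
  set Z : periodHomologyHecke N := ∑ j : Fin p, symbolInt N (β j) +
      ∑ k ∈ Finset.range p, (shiftInt N h9 ^ k) (symbolInt N β') with hZ
  have hZcoe : (Z : Module.Dual ℂ (CuspForm (Gamma0 N) 2)) = ∑ j : Fin p, periodFunctional N (β j) +
      ∑ k ∈ Finset.range p, (t ^ k) (periodFunctional N β') := by
    rw [hZ, Submodule.coe_add, AddSubmonoidClass.coe_finsetSum, AddSubmonoidClass.coe_finsetSum]
    simp only [coe_shiftInt_pow_eq, coe_symbolInt, ht]
  obtain ⟨w, hw⟩ := (mem_shiftSubOneLattice_iff N h9 _).mp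
    (three_smul_mem_shiftSubOneLattice N h9 (symbolInt_mem_prymLattice_of_parabolic N h9 γ hs))
  have hwcoe : t (w : Module.Dual ℂ (CuspForm (Gamma0 N) 2)) - w = δ + δ + δ := by
    have h := congrArg (fun z : periodHomologyHecke N ↦ (z : Module.Dual ℂ (CuspForm (Gamma0 N) 2))) hw
    simp only [Submodule.coe_sub, coe_shiftInt, Submodule.coe_smul_of_tower] at h
    rw [ht, h, hδ]
    abel
  -- the Hecke computation on functionals: `T_p^∨ δ = (t − 1)Z + (p + 1)δ`
  have hTsmul : HeckeRing0.T N 2 p hp • δ = (heckeT (Gamma0 N) 2 p).dualMap δ := by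
    ext f
    rw [HeckeRing0.smul_dual_apply, HeckeRing0.toEnd_T, LinearMap.dualMap_apply]
  have hT : (heckeT (Gamma0 N) 2 p).dualMap δ = (t - 1) (Z : Module.Dual ℂ _) + (p + 1) • δ := by
    calc (heckeT (Gamma0 N) 2 p).dualMap δ
        = (t - 1) (∑ j : Fin p, (inftyFunctional (cuspMatrix ((x + ((j : ℕ) : ℤ)) / p)) : Module.Dual ℂ (CuspForm (Gamma0 N) 2)) +
            ∑ k ∈ Finset.range p, (t ^ k) ((inftyFunctional (cuspMatrix (p * x)) : Module.Dual ℂ (CuspForm (Gamma0 N) 2)))) := by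
          rw [hδ', hψ, ht]
          exact dualMap_heckeT_shiftDual_sub_inftyFunctional N h9 hp hpN hp1 x
      _ = (t - 1) (∑ j : Fin p, (periodFunctional N (β j) + ψ) +
            ∑ k ∈ Finset.range p, (t ^ k) (periodFunctional N β' + ψ)) := by
          rw [Finset.sum_congr rfl fun j _ ↦ hβ j, hβ'']
      _ = (t - 1) (Z : Module.Dual ℂ _) + (p • (t - 1) ψ + (t - 1) (∑ k ∈ Finset.range p, (t ^ k) ψ)) := by
          rw [hZcoe]
          simp only [map_add, map_sum, Finset.sum_add_distrib, Finset.sum_const, Finset.card_univ,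
            Fintype.card_fin, map_nsmul]
          abel
      _ = (t - 1) (Z : Module.Dual ℂ _) + (p • δ + δ) := by
          have hδt' : δ = (t - 1) ψ := by rw [LinearMap.sub_apply, Module.End.one_apply]; exact hδt
          rw [ht, shiftDual_sub_one_sum_pow_apply N h9 p ψ, shiftDual_pow_eq_of_mod_three_eq_one N h9 hp1, ← ht,
            ← hδt']
      _ = (t - 1) (Z : Module.Dual ℂ _) + (p + 1) • δ := by rw [succ_nsmul]
  -- conclusion: `(T_p − 2)δ = (t − 1)(Z + m w)`
  rw [mem_shiftSubOneLattice_iff]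
  refine ⟨Z + m • w, Subtype.ext ?_⟩
  have hp1' : p + 1 = 3 * m + 2 := by omega
  have htw : t (w : Module.Dual ℂ (CuspForm (Gamma0 N) 2)) = w + (δ + δ + δ) := by rw [← hwcoe]; abel
  rw [Submodule.coe_sub, coe_shiftInt, Submodule.coe_add, Submodule.coe_smul_of_tower, Submodule.coe_smul,
    sub_smul, hTsmul, hT, two_heckeRing0_smul, ← hδ, ← ht, hp1', map_add, map_nsmul, htw, LinearMap.sub_apply,
    Module.End.one_apply]
  module

end Parabolic

end Literature.NumberTheory.ModularSymbols
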